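import Summits.Schanuel.Schanuel.Theorems.RootDecomp1KNW96Core07
import Literature.NumberTheory.Transcendental.ExpAlgebraicApproximationMeasure

/-!
# RootDecomp1KNW96Core — lens 6, generation 24 «NW96 THEOREM 5(1) AS PRINTED (105500), HYPOTHESIS-FREE» (RULE G25 (iii); CLAIM L2202/L2203, CHECKLIST G25-α = ACK L2204, NODE L2222 / REQUEST L2223, writer re-check L2227, critic VERDICT L2233: CLEARED — THEOREM ×1 «`theorem …RootDecomp1KNW96Core.nesterenkoWaldschmidt1996_thm_5_1_holds : Literature.NumberTheory.Transcendental.NesterenkoWaldschmidt1996_thm_5_1` by proof»; the AUDIT-G22 gap «thm_5_1 registered, unproved» CLOSED; RULE G26; lens-6 tally THEOREM ×8 + CELL ×3 + AUDIT ×1) — continuation (RootDecomp1KNW96Core10): §1–§2 numerics, `cellB_core`, `F3_le_regimeI`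

(lens-6 g24 HOME kernel K = HOME/decomp-schanuel-lens-6/g24/NW96Thm51.lean b14a307c…, 880 l, imports tree `…RootDecomp1KNW96Core07` + Literature `…ExpAlgebraicApproximationMeasure`; P NW96Thm51Probe.lean 86491eb5… rc 0; C NW96Thm51Controls.lean 2460ef9c… rc 1 = exactly the 9 planted errors. Port by census-1 gen 19 as `RootDecomp1KNW96Core10`–`12` (the verdict's «Core10, one file, 880 l» split for the 400-line cap): 10 = §1–§2 numerics (`exp`/`log` pins, `log(t+2) ≤ log t + 2/t`, `x ≤ e^{x−1}`, `e·x ≤ e^x`, `x²e^{2−x} ≤ e·x`, `e²x ≤ 2e^x`, `W ≤ 19.4366`), the link cell core `cellB_core` per `D ∈ {1,2,3,4}, ≥ 5` and `F3_le_regimeI`; 11 = the FOUR NAMED CELLS `cell_IA` (120), `cell_IB` (252 ≤ 263.75), `regimeII_eb`, `cell_IIA` (1046.052 ≤ 1055, binding), `cell_IIB` (link cell); 12 = `thm51_budget`, the ONE comparison theorem `thm51_exponent_le` (constant 1055/4 · c) + `_400`, `norm_le_thm51_exponent`, §3 the c-generic slot `NW1996Thm51C`, `nw1996Thm51C_iff`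 (Iff.rfl), (a) `weilHeight₁_unit_eq_vec`, (b) the LINK `neg_height_le_log_norm`, (c) `exp_neg_le_norm_exp_sub_zero`, the instance `thm51C_of_mainR (hc : 1 ≤ c) (hNW : NW1996MainR c) : NW1996Thm51C (1055/4 * c)` (θ := β, A′ := A, B′ := e^{h(β)}, E′ := max(E, e²)), `nw1996Thm51C_105500` and the headline `nesterenkoWaldschmidt1996_thm_5_1_holds` HYPOTHESIS-FREE.
PORT EDITS: the file-wide `set_option linter.dupNamespace false` dropped; the thirteen generic `exp`/`log` numerics lemmas of §1 made `private` (dedup-safety: Literature twins) and K's `log_add_two_le` (log(t+2) ≤ log t + 2/t) RENAMED `log_add_two_le_two_div` — the gate's fqn lint refuses the short name, already taken by Core08's `log_add_two_le` (log(n+2) ≤ log n + 1.1) in the same namespace with per-part private copies where a later part uses them; the slot def's docstring tagged «[slot] c-generic statement def …» (census convention, verdict condition); statements and proofs otherwise verbatim. `--supports stmt-Schanuel-33364`; no census credit carried; rung 0 — nothing here proves Schanuel. CONSEQUENCE OF RECORD (G25 (i) pattern, RULE G26 (i)): every `(hNW : NesterenkoWaldschmidt1996_thm_5_1)` binder in the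 tree (Hyper19, FiniteOrderCell04, StoreyOneAtlas02, PowerLineOrder02 …) is dischargeable BY NAME — census relabel bookkeeping ×0; the Literature `_holds` companion waits for the relocation of the NW96Core chain into Literature (Literature must not import Summits).)
-/

noncomputable section

namespace Summit.Schanuel.Schanuel.Theorems.RootDecomp1KNW96Core

open Literature.NumberTheory.Transcendental

section Thm51Numerics

open Real

/-!
# Nesterenko–Waldschmidt 1996, Theorem 5 (1) AS PRINTED (constant `105500`), HYPOTHESIS-FREE

decomp-schanuel lens-6 g24, RULE G25 (iii) «by-proof discharge of the registered
`NesterenkoWaldschmidt1996_thm_5_1` exactly as printed»; CHECKLIST G25-α (cell bus, crit-1 g9,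
2026-08-31T18:44:16Z).

TARGET (the registered Literature fact BY NAME, `ExpAlgebraicApproximationMeasure.lean` l.33–47,
constant `105500` untouched, no local shadow):
`theorem nesterenkoWaldschmidt1996_thm_5_1_holds : NesterenkoWaldschmidt1996_thm_5_1`.

ENGINE = INSTANCE of the tree's own Theorem 1, `nw1996MainR_400 : NW1996MainR 400`
(`RootDecomp1KNW96Core07` l.143; `θ : ℂ` in that text, so complex `β` is covered), applied at
`θ := β`, `α := α`, `β := β`, `A′ := A`, `B′ := e^{h(β)}`, `E′ := max(E, e²)` — NOT at the print's
`E′ = E` (whose comparison factor `sup ≈ 499.55` needs `c · 499.55 ≤ 105500`, false for `c = 400`) — plus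

* (a) the re-indexing identity `weilHeight₁_unit_eq_vec : h_F(fun _ : Unit ↦ x) = h_F(![x])`;
* (b) the height–modulus LINK `neg_height_le_log_norm : −D·h_F(β) ≤ log |β|` (Liouville with one
  monomial, from Core01 `liouville₂_sharp`) — load-bearing: it excludes the printed corner `D = 1`,
  `E = e`, `log A = 1`, `|β| = 1/e`, `h(β) = 0`, where the link-free comparison factor is `363 > 1055/4`;
* (c) the corner `α = 0` (outside Theorem 1), fact-free: `|e^β| = e^{Re β} ≥ e^{−|β|}` and
  `|β| ≤` Theorem 5's exponent (`exp_neg_le_norm_exp_sub_zero`, `norm_le_thm51_exponent`);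
* the exponent comparison `thm51_exponent_le` (generic in `c`): Theorem 1's exponent at
  `(β, A, e^{h(β)}, max(E, e²))` is at most `(1055/4)·c · D² log A (h(β) + log₊ log A + log D + log E)
  (D log D + log E)/(log E)²`; with `c = 400`, `(1055/4)·400 = 105500` on the nose.

Hence `thm51C_of_mainR : 1 ≤ c → NW1996MainR c → NW1996Thm51C ((1055/4)·c)` for the parametrised
text `NW1996Thm51C` (`NW1996Thm51C 105500 ↔ NesterenkoWaldschmidt1996_thm_5_1` by `Iff.rfl`), and the
target from `nw1996MainR_400`.

## The budget (§2), variables and cells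

`D = [ℚ(α,β):ℚ] = n ≥ 1`, `x = log E ≥ 1`, `L = log A` (`x ≤ D L`), `b = |β|` (`b e^x ≤ D L`),
`h = h(β) ≥ 0`, LINK `log b ≥ −D h`; atoms `S = D L ≥ 1`, `σ = log S`, `u = log D`, `ℓ = log₊ L ≥
max(0, σ − u)`, `lb = log₊ b ≤ max(0, σ − x)`, `y = max(x, 2)`.  Theorem 1's factors
`F₁ = h + log L + 4u + 2(y + lb) + 10`, `F₂ = S + 2 e^y b + 6y`, `F₃ = 3.3 D log(D+2) + y` against
Theorem 5's `T₁ = h + ℓ + u + x`, `T₃ = D u + x`:  `thm51_budget : F₁ F₂ F₃ · x² ≤ (1055/4) · S · T₁ T₃ · y²`,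
by four NAMED cells:

* `cell_IA`  (`x ≥ 2`, `σ ≥ x`): `F₁ ≤ 6T₁`, `F₂ ≤ 5S`, `F₃ ≤ 4T₃` (`F3_le_regimeI`): `120 ≤ 1055/4`;
* `cell_IB`  (`x ≥ 2`, `σ < x`, `lb = 0`): `F₁ ≤ 7T₁`, `F₂ ≤ 9S`, `F₃ ≤ 4T₃`: `252 ≤ 1055/4`;
* `cell_IIA` (`x ≤ 2`, `σ ≥ x`): `F₁ ≤ 9T₁`, `F₂x² ≤ 11.86·Sx`, `x F₃ ≤ 9.8 T₃`: `1046.052 ≤ 1055`;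
* `cell_IIB` (`x ≤ 2`, `σ < x`, the LINK cell): slope `F₂x²F₃ ≤ 334.3·S T₃ ≤ 1055·S T₃` and the
  degree inequality `cellB_core` (one display per `D ∈ {1,2,3,4}`, one for `D ≥ 5`:
  `D·(x+3u+14)·xW·(F₃) ≤ 1055·(x − u + D(u+x))·T₃`, `W = x + 2e + 12 ≤ 19.4366`), combined linearly in
  `h ≥ (x − σ)/D`.

Numeric pins (§1, each a displayed lemma): `e` to 9 digits (Mathlib `Real.exp_one_gt_d9/lt_d9`),
`e² > 7.389`, `log 2` to 9 digits (Mathlib), `log 3 ∈ [12/11, 11/10]` (tree `log_consts`, Core06),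
`log 4 = 2 log 2`, `log 5 ≤ 2 log 2 + 1/4`, `2 log 2 + 1/5 ≤ log 5`, `log 6 = log 2 + log 3`,
`log(t+2) ≤ log t + 2/t`, `x ≤ e^{x−1}`, `e·x ≤ e^x`, `x² e^{2−x} ≤ e·x`, `e²·x ≤ 2 e^x` (`x ≥ 2`).

GUARDS: imports = tree `RootDecomp1KNW96Core07` (hence Core01–06 and the NW96 Literature statement files)
+ Literature `ExpAlgebraicApproximationMeasure` only; namespace
`Summit.Schanuel.Schanuel.Theorems.RootDecomp1KNW96Core` (same as Core01–07); no `sorry`, no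
`native_decide`, NO `set_option maxHeartbeats` anywhere; `set_option linter.dupNamespace false` only
(dropped at port); axioms `[propext, Classical.choice, Quot.sound]` (probe file).  PORT NOTE (census):
the theorem proves a Literature fact but depends on Summit-side Core01/Core07, so it lands Summit-side
(`RootDecomp1KNW96CoreNN --supports stmt-Schanuel-33364`); the Literature `_holds` companion waits for
the relocation of the NW96Core chain.
-/

/-- `2.7182818283 < e < 2.7182818286`. [folklore] -/
private theorem exp_one_bounds : (2.7182818283 : ℝ) < exp 1 ∧ exp 1 < 2.7182818286 :=
  ⟨Real.exp_one_gt_d9, Real.exp_one_lt_d9⟩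

/-- `7.389 < e²`. [folklore] -/
private theorem exp_two_gt : (7.389 : ℝ) < exp 2 := by
  have h := Real.exp_one_gt_d9
  have e : exp 2 = exp 1 * exp 1 := by rw [← Real.exp_add]; norm_num
  rw [e]; nlinarith

/-- `0.6931471803 < log 2 < 0.6931471808`. [folklore] -/
private theorem log_two_bounds : (0.6931471803 : ℝ) < log 2 ∧ log 2 < 0.6931471808 :=
  ⟨Real.log_two_gt_d9, Real.log_two_lt_d9⟩

/-- `log 4 = 2 log 2`. [folklore] -/
private theorem log_four_eq : log (4 : ℝ) = 2 * log 2 := by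
  rw [show (4 : ℝ) = 2 ^ 2 by norm_num, Real.log_pow]; norm_num

/-- `log 5 ≤ 2 log 2 + 1/4` (`log(5/4) ≤ 1/4`). [folklore] -/
private theorem log_five_le : log (5 : ℝ) ≤ 2 * log 2 + 1 / 4 := by
  have h : log (5 : ℝ) = log 4 + log (5 / 4) := by
    rw [← Real.log_mul (by norm_num) (by norm_num)]; norm_num
  have h2 : log (5 / 4 : ℝ) ≤ 5 / 4 - 1 := Real.log_le_sub_one_of_pos (by norm_num)
  rw [h, log_four_eq]; linarith

/-- `2 log 2 + 1/5 ≤ log 5` (`1 − 4/5 ≤ log(5/4)`). [folklore] -/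
private theorem le_log_five : 2 * log 2 + 1 / 5 ≤ log (5 : ℝ) := by
  have h : log (5 : ℝ) = log 4 + log (5 / 4) := by
    rw [← Real.log_mul (by norm_num) (by norm_num)]; norm_num
  have h2 : 1 - (5 / 4 : ℝ)⁻¹ ≤ log (5 / 4 : ℝ) := Real.one_sub_inv_le_log_of_pos (by norm_num)
  rw [h, log_four_eq]; norm_num at h2 ⊢; linarith

/-- `log 6 = log 2 + log 3`. [folklore] -/
private theorem log_six_eq : log (6 : ℝ) = log 2 + log 3 := by
  rw [show (6 : ℝ) = 2 * 3 by norm_num, Real.log_mul (by norm_num) (by norm_num)]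

/-- `log (t + 2) ≤ log t + 2/t` for `t ≥ 1` (`log(1 + 2/t) ≤ 2/t`). [folklore] -/
private theorem log_add_two_le_two_div {t : ℝ} (ht : 1 ≤ t) : log (t + 2) ≤ log t + 2 / t := by
  have ht0 : 0 < t := by linarith
  have e : t + 2 = t * (1 + 2 / t) := by field_simp
  rw [e, Real.log_mul ht0.ne' (by positivity)]
  have := Real.log_le_sub_one_of_pos (show (0 : ℝ) < 1 + 2 / t by positivity)
  linarith

/-- `x ≤ e^{x−1}`. [folklore] -/
private theorem le_exp_sub_one (x : ℝ) : x ≤ exp (x - 1) := by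
  have := Real.add_one_le_exp (x - 1); linarith

/-- `e·x ≤ e^x`. [folklore] -/
private theorem exp_one_mul_le_exp (x : ℝ) : exp 1 * x ≤ exp x := by
  have h := le_exp_sub_one x
  have e : exp x = exp 1 * exp (x - 1) := by rw [← Real.exp_add]; ring_nf
  rw [e]; exact mul_le_mul_of_nonneg_left h (exp_pos 1).le

/-- `x²·e^{2−x} ≤ e·x` for `x ≥ 0`. [folklore] -/
private theorem sq_mul_exp_two_sub_le {x : ℝ} (hx : 0 ≤ x) : x ^ 2 * exp (2 - x) ≤ exp 1 * x := by
  have h := exp_one_mul_le_exp x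
  have e : exp 1 * x = (exp 1 * x) * (exp (2 - x) * exp (x - 1)) / exp 1 := by
    rw [← Real.exp_add]; field_simp; ring_nf
  have e2 : x ^ 2 * exp (2 - x) = x * (exp (2 - x) * x) := by ring
  rw [e2]
  have : exp (2 - x) * x ≤ exp (2 - x) * exp (x - 1) :=
    mul_le_mul_of_nonneg_left (le_exp_sub_one x) (exp_pos _).le
  calc x * (exp (2 - x) * x) ≤ x * (exp (2 - x) * exp (x - 1)) := mul_le_mul_of_nonneg_left this hx
    _ = exp 1 * x := by rw [← Real.exp_add]; ring_nf

/-- `e²·x ≤ 2·e^x` for `x ≥ 2` (`e^{x−2} ≥ x − 1 ≥ x/2`). [folklore] -/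
private theorem exp_two_mul_le {x : ℝ} (hx : 2 ≤ x) : exp 2 * x ≤ 2 * exp x := by
  have h := Real.add_one_le_exp (x - 2)
  have e : exp x = exp 2 * exp (x - 2) := by rw [← Real.exp_add]; ring_nf
  rw [e]; nlinarith [exp_pos (2 : ℝ), exp_pos (x - 2)]

/-! ### The `σ < x`, `log E ≤ 2` cell: one displayed inequality per degree `D ∈ {1,2,3,4}` and one for `D ≥ 5`

With `u = log D`, `W = x + 2e + 12`, `F₃ = 3.3·D·log(D+2) + 2`, `P = x + 3u + 14`, `Q_D = x − u + D(u + x)`,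
`T₃ = D u + x`:  `D · P · (x W F₃) ≤ 1055 · Q_D · T₃` for `1 ≤ x ≤ 2`. -/

/-- `W = x + 2e + 12 ≤ 19.4366` on `x ≤ 2`. [folklore] -/
private theorem W_le {x : ℝ} (hx2 : x ≤ 2) : x + 2 * exp 1 + 12 ≤ 19.4366 := by
  linarith [exp_one_bounds.2]

set_option maxHeartbeats 400000 in
/-- The cell inequality, all degrees. [cite: NesterenkoWaldschmidt1996, Theorem 5 (1) via Theorem 1] -/
theorem cellB_core (n : ℕ) (hn : 1 ≤ n) {x : ℝ} (hx : 1 ≤ x) (hx2 : x ≤ 2) :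
    (n : ℝ) * ((x + 3 * log n + 14) * (x * (x + 2 * exp 1 + 12) * (33 / 10 * n * log ((n : ℝ) + 2) + 2))) ≤
      1055 * (x - log n + n * (log n + x)) * (n * log n + x) := by
  have hW := W_le hx2
  have hW0 : 0 < x + 2 * exp 1 + 12 := by positivity
  have hx0 : 0 ≤ x := by linarith
  obtain ⟨hl2a, hl2b⟩ := log_two_bounds
  rcases (by omega : n = 1 ∨ n = 2 ∨ n = 3 ∨ n = 4 ∨ 5 ≤ n) with h1 | h2 | h3 | h4 | h5
  · -- D = 1: `(x+14)·W·(3.3 log 3 + 2) ≤ 16·19.4366·5.63 ≤ 1751 ≤ 2110 x`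
    subst h1
    simp only [Nat.cast_one, Real.log_one, mul_zero, add_zero, sub_zero, zero_add, one_mul, mul_one]
    have hl3 : log (3 : ℝ) ≤ 11 / 10 := log_consts.2.1
    have hl30 : 0 ≤ log (3 : ℝ) := Real.log_nonneg (by norm_num)
    have k1 : (x + 14) * (x + 2 * exp 1 + 12) ≤ 16 * 19.4366 :=
      mul_le_mul (by linarith) hW hW0.le (by norm_num)
    have k2 : (x + 14) * (x + 2 * exp 1 + 12) * (33 / 10 * log 3 + 2) ≤ 16 * 19.4366 * (563 / 100) :=
      mul_le_mul k1 (by linarith) (by positivity) (by norm_num)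
    have k3 := mul_le_mul_of_nonneg_left k2 hx0
    nlinarith [k3]
  · -- D = 2: `P ≤ 18.0795`, `F₃ = 13.2 log 2 + 2 ≤ 11.1496`; `2·3919·x ≤ 1055 (3x + log 2)(2 log 2 + x)`
    subst h2
    have e4 : (2 : ℝ) + 2 = 4 := by norm_num
    simp only [Nat.cast_ofNat, e4, log_four_eq]
    have kP : x + 3 * log 2 + 14 ≤ 18.0795 := by linarith
    have kF : 33 / 10 * 2 * (2 * log 2) + 2 ≤ 11.1496 := by linarith
    have kF0 : 0 ≤ 33 / 10 * 2 * (2 * log 2) + 2 := by linarith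
    have k1 : (x + 2 * exp 1 + 12) * (33 / 10 * 2 * (2 * log 2) + 2) ≤ 19.4366 * 11.1496 :=
      mul_le_mul hW kF kF0 (by norm_num)
    have k2 : (x + 3 * log 2 + 14) * ((x + 2 * exp 1 + 12) * (33 / 10 * 2 * (2 * log 2) + 2)) ≤
        18.0795 * (19.4366 * 11.1496) :=
      mul_le_mul kP k1 (by positivity) (by norm_num)
    have k3 := mul_le_mul_of_nonneg_left k2 hx0
    have e : (2 : ℝ) * ((x + 3 * log 2 + 14) * (x * (x + 2 * exp 1 + 12) * (33 / 10 * 2 * (2 * log 2) + 2))) =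
        2 * (x * ((x + 3 * log 2 + 14) * ((x + 2 * exp 1 + 12) * (33 / 10 * 2 * (2 * log 2) + 2)))) := by
      ring
    rw [e]
    nlinarith [k3, sq_nonneg (x - 1 / 2)]
  · -- D = 3: `P ≤ 19.3`, `F₃ = 9.9 log 5 + 2 ≤ 18.2`; `3·6828·x ≤ 1055 (4x + 2 log 3)(3 log 3 + x)`
    subst h3
    have e5 : (3 : ℝ) + 2 = 5 := by norm_num
    simp only [Nat.cast_ofNat, e5]
    have hl3 : log (3 : ℝ) ≤ 11 / 10 := log_consts.2.1
    have hl3' : 12 / 11 ≤ log (3 : ℝ) := log_consts.2.2.2.2.2.2.2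
    have hl5 := log_five_le
    have hl50 : 0 ≤ log (5 : ℝ) := Real.log_nonneg (by norm_num)
    have kP : x + 3 * log 3 + 14 ≤ 19.3 := by linarith
    have kF : 33 / 10 * 3 * log 5 + 2 ≤ 18.2 := by linarith
    have kF0 : 0 ≤ 33 / 10 * 3 * log 5 + 2 := by positivity
    have k1 : (x + 2 * exp 1 + 12) * (33 / 10 * 3 * log 5 + 2) ≤ 19.4366 * 18.2 :=
      mul_le_mul hW kF kF0 (by norm_num)
    have k2 : (x + 3 * log 3 + 14) * ((x + 2 * exp 1 + 12) * (33 / 10 * 3 * log 5 + 2)) ≤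
        19.3 * (19.4366 * 18.2) :=
      mul_le_mul kP k1 (by positivity) (by norm_num)
    have k3 := mul_le_mul_of_nonneg_left k2 hx0
    have e : (3 : ℝ) * ((x + 3 * log 3 + 14) * (x * (x + 2 * exp 1 + 12) * (33 / 10 * 3 * log 5 + 2))) =
        3 * (x * ((x + 3 * log 3 + 14) * ((x + 2 * exp 1 + 12) * (33 / 10 * 3 * log 5 + 2)))) := by
      ring
    rw [e]
    nlinarith [k3, sq_nonneg (x - 1 / 2), mul_nonneg hx0 (sub_nonneg.2 hl3')]
  · -- D = 4: `P ≤ 20.159`, `F₃ = 13.2 log 6 + 2 ≤ 25.67`; `4·10059·x ≤ 1055 (5x + 3 log 4)(4 log 4 + x)`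
    subst h4
    have e6 : (4 : ℝ) + 2 = 6 := by norm_num
    simp only [Nat.cast_ofNat, e6, log_four_eq, log_six_eq]
    have hl3 : log (3 : ℝ) ≤ 11 / 10 := log_consts.2.1
    have hl30 : 0 ≤ log (3 : ℝ) := Real.log_nonneg (by norm_num)
    have kP : x + 3 * (2 * log 2) + 14 ≤ 20.159 := by linarith
    have kF : 33 / 10 * 4 * (log 2 + log 3) + 2 ≤ 25.67 := by linarith
    have kF0 : 0 ≤ 33 / 10 * 4 * (log 2 + log 3) + 2 := by positivity
    have k1 : (x + 2 * exp 1 + 12) * (33 / 10 * 4 * (log 2 + log 3) + 2) ≤ 19.4366 * 25.67 :=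
      mul_le_mul hW kF kF0 (by norm_num)
    have k2 : (x + 3 * (2 * log 2) + 14) * ((x + 2 * exp 1 + 12) * (33 / 10 * 4 * (log 2 + log 3) + 2)) ≤
        20.159 * (19.4366 * 25.67) :=
      mul_le_mul kP k1 (by positivity) (by norm_num)
    have k3 := mul_le_mul_of_nonneg_left k2 hx0
    have e : (4 : ℝ) * ((x + 3 * (2 * log 2) + 14) *
          (x * (x + 2 * exp 1 + 12) * (33 / 10 * 4 * (log 2 + log 3) + 2))) =
        4 * (x * ((x + 3 * (2 * log 2) + 14) *
          ((x + 2 * exp 1 + 12) * (33 / 10 * 4 * (log 2 + log 3) + 2)))) := by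
      ring
    rw [e]
    nlinarith [k3, sq_nonneg (x - 1 / 2)]
  · -- D ≥ 5: `u = log D ≥ 1.5863`, `F₃ ≤ 3.3 D u + 8.6`, `P ≤ 3u + 16`;
    -- `(3u+16)·19.4366·(3.3Du+8.6) ≤ 1055 (1 + 0.4u)(Du+1)` and `D(1+0.4u) ≤ D + u(D−1)/2`.
    have hD5 : (5 : ℝ) ≤ (n : ℝ) := by exact_mod_cast h5
    generalize hD : (n : ℝ) = D at hD5 ⊢
    have hD0 : (0 : ℝ) < D := by linarith
    have hu5 : 1.5862 ≤ log D := by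
      have h1 := le_log_five
      have h2 : log 5 ≤ log D := Real.log_le_log (by norm_num) hD5
      linarith
    have hF3 : 33 / 10 * D * log (D + 2) + 2 ≤ 33 / 10 * D * log D + 43 / 5 := by
      have h1 := log_add_two_le_two_div (show (1 : ℝ) ≤ D by linarith)
      have h2 := mul_le_mul_of_nonneg_left h1 (show (0 : ℝ) ≤ 33 / 10 * D by positivity)
      have e : 33 / 10 * D * (log D + 2 / D) = 33 / 10 * D * log D + 33 / 5 := by field_simp; ring
      linarith
    have hF30 : 0 ≤ 33 / 10 * D * log (D + 2) + 2 := by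
      have : 0 ≤ log (D + 2) := Real.log_nonneg (by linarith)
      positivity
    generalize hF : 33 / 10 * D * log (D + 2) + 2 = F at hF3 hF30 ⊢
    generalize hu : log D = u at hu5 hF3 ⊢
    have hu0 : 0 ≤ u := by linarith
    have kP : x + 3 * u + 14 ≤ 3 * u + 16 := by linarith
    -- G = (3u+16)(19.4366 (3.3Du + 8.6)) and the two displayed comparisons
    have k1 : (x + 2 * exp 1 + 12) * F ≤ 19.4366 * (33 / 10 * D * u + 43 / 5) :=
      mul_le_mul hW hF3 hF30 (by norm_num)
    have k2 : (x + 3 * u + 14) * ((x + 2 * exp 1 + 12) * F) ≤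
        (3 * u + 16) * (19.4366 * (33 / 10 * D * u + 43 / 5)) :=
      mul_le_mul kP k1 (by positivity) (by positivity)
    have k3 := mul_le_mul_of_nonneg_left k2 hx0
    have g1 : (3 * u + 16) * (19.4366 * (33 / 10 * D * u + 43 / 5)) ≤ 1055 * (1 + 2 / 5 * u) * (D * u + 1) := by
      nlinarith [mul_nonneg (sub_nonneg.2 hD5) hu0, mul_nonneg (mul_nonneg (sub_nonneg.2 hD5) hu0) hu0,
        mul_nonneg (sub_nonneg.2 hu5) hu0, mul_nonneg (mul_nonneg (sub_nonneg.2 hu5) hu0) hD0.le]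
    have g2 : D * (1 + 2 / 5 * u) ≤ D + u * (D - 1) / 2 := by nlinarith
    have g3 : x * (D + u * (D - 1) / 2) ≤ x - u + D * (u + x) := by nlinarith
    have g4 : D * u + 1 ≤ D * u + x := by linarith
    have gQ0 : 0 ≤ x * (D + u * (D - 1) / 2) := by
      have : 0 ≤ u * (D - 1) / 2 := by
        have : 0 ≤ D - 1 := by linarith
        positivity
      positivity
    -- chain
    have e : D * ((x + 3 * u + 14) * (x * (x + 2 * exp 1 + 12) * F)) =
        x * (D * ((x + 3 * u + 14) * ((x + 2 * exp 1 + 12) * F))) := by ring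
    rw [e]
    calc x * (D * ((x + 3 * u + 14) * ((x + 2 * exp 1 + 12) * F)))
        ≤ x * (D * ((3 * u + 16) * (19.4366 * (33 / 10 * D * u + 43 / 5)))) :=
          mul_le_mul_of_nonneg_left (mul_le_mul_of_nonneg_left k2 hD0.le) hx0
      _ ≤ x * (D * (1055 * (1 + 2 / 5 * u) * (D * u + 1))) :=
          mul_le_mul_of_nonneg_left (mul_le_mul_of_nonneg_left g1 hD0.le) hx0
      _ = 1055 * (x * (D * (1 + 2 / 5 * u))) * (D * u + 1) := by ring
      _ ≤ 1055 * (x * (D + u * (D - 1) / 2)) * (D * u + 1) := by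
          have h1 := mul_le_mul_of_nonneg_left g2 hx0
          have h0 : 0 ≤ D * u + 1 := by positivity
          have h2 := mul_le_mul_of_nonneg_right h1 h0
          have h3 := mul_le_mul_of_nonneg_left h2 (show (0 : ℝ) ≤ 1055 by norm_num)
          simpa only [mul_assoc] using h3
      _ ≤ 1055 * (x - u + D * (u + x)) * (D * u + x) := by
          have h0 : 0 ≤ D * u + 1 := by positivity
          have h0' : 0 ≤ x - u + D * (u + x) := gQ0.trans g3
          have h2 := mul_le_mul g3 g4 h0 h0'
          have h3 := mul_le_mul_of_nonneg_left h2 (show (0 : ℝ) ≤ 1055 by norm_num)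
          simpa only [mul_assoc] using h3

/-! ### The exponent budget: Theorem 1 (any constant `c`) at `θ = β`, `E' = max(E, e²)`, `B' = e^{h(β)}`
versus Theorem 5 (1) with `(1055/4)·c`

Variables: `D = [K:ℚ]` (`n` below), `x = log E ≥ 1`, `L = log A` with `x ≤ D L`, `b = |β|` with
`b e^x ≤ D L`, `h = h(β) ≥ 0` with the height–modulus LINK `log b ≥ −D h`.  The three Theorem-1 factors
`F₁ = h + log L + 4 log D + 2(y + log₊ b) + 10`, `F₂ = D L + 2 e^y b + 6 y`, `F₃ = 3.3 D log(D+2) + y`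
(`y = max(x, 2)`) against the two Theorem-5 factors `T₁ = h + log₊ L + log D + x`, `T₃ = D log D + x`:
`F₁ F₂ F₃ · x² ≤ (1055/4) · D L · T₁ T₃ · y²`. -/

/-- `F₃ ≤ 4 T₃` in the regime `x ≥ 2`. [folklore] -/
theorem F3_le_regimeI (n : ℕ) (hn : 1 ≤ n) {x : ℝ} (hx2 : 2 ≤ x) :
    33 / 10 * n * log ((n : ℝ) + 2) + x ≤ 4 * (n * log n + x) := by
  rcases (by omega : n = 1 ∨ 2 ≤ n) with h1 | h2
  · subst h1
    simp only [Nat.cast_one, Real.log_one, mul_zero, zero_add, mul_one]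
    have := log_consts.2.1
    linarith
  · have hD1 : (1 : ℝ) ≤ n := by exact_mod_cast hn
    have hD2 : (2 : ℝ) ≤ n := by exact_mod_cast h2
    have hl : log ((n : ℝ) + 2) ≤ log n + 2 / n := log_add_two_le_two_div hD1
    have hu2 : 0.6931471803 ≤ log (n : ℝ) :=
      le_trans log_two_bounds.1.le (Real.log_le_log two_pos hD2)
    have h1 := mul_le_mul_of_nonneg_left hl (by positivity : (0 : ℝ) ≤ 33 / 10 * n)
    have e : 33 / 10 * (n : ℝ) * (log n + 2 / n) = 33 / 10 * n * log n + 33 / 5 := by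
      field_simp; ring
    have hnl : 2 * 0.6931471803 ≤ (n : ℝ) * log n := mul_le_mul hD2 hu2 (by norm_num) (by positivity)
    linarith

end Thm51Numerics

end Summit.Schanuel.Schanuel.Theorems.RootDecomp1KNW96Core

end
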